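import Literature.Computability.AlgebraicComplexity.ConstituentStageAssembly
import Literature.Computability.AlgebraicComplexity.ConstituentStageCounts
import Literature.Computability.AlgebraicComplexity.GlobalStageParameters
import HarnessLib

/-!
# The constituent stage, one region: choosing the hashing parameters
(Vassilevska Williams–Xu–Xu–Zhou 2024, Prop. 6.2 / §6.2 and §6.6: `M₀`, `M ∈ [M₀, 2M₀]` prime, the
Salem–Spencer set `B`) — proved

Topic `Literature/Computability/AlgebraicComplexity`.  §6.2 and §6.6 of Vassilevska Williams–Xu–Xu–Zhou,
*New bounds for matrix multiplication: from alpha to omega* (SODA 2024, arXiv:2307.07970): "Let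
`M ∈ [M₀, 2M₀]` be a prime number … we first require that `M₀ ≥ 8 · max{numtriple/numxblock,
numtriple/numyblock}` … Next, for a Salem–Spencer subset `B` of `{0,…,M−1}` that has size `M^{1−o(1)}`
… we add another (and final) constraint: `M₀ ≥ (numalpha · p_comp/numzblock) · n²`."  This file
discharges the counting requirements of the exact one-region statement `vxxz2024_prop62_region`
(`ConstituentStageAssembly.lean`) by this choice, for the data `D : ConstituentRegion c n s M₁` of one
region (any `M₁`; the modulus is re-chosen):

* `usefulZCount_eq_of_mem`, `card_firstTypeHolesX/Y/Z_eq_of_mem` — by the symmetry of the consistent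
  triples (`ConstituentStageCompatCount.lean`), `M_Z(T)` and the first-type hole counts do not depend on
  the consistent triple;
* `modulusBound` — `M₀ = max{8 numtriple/numxblock + 1, 8 numtriple/numyblock + 1, 160 · c · 2n · V, 2c+2}`
  with `V = ⌈numalpha · C / m⌉`, `m` a lower bound on the class sizes `#{K̂' : ξ(K̂') = ξ(K̂)}` of the
  admitted useful `Z`-blocks (Claim 6.13: `U_A(T) · m ≤ M_Z · numalpha · C`, `card_holePairsIn_mul_le`);
* `vxxz2024_prop62_region_parameters` — **Prop. 6.2, one region, with the parameters chosen**: there are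
  a prime `M₀ < M ≤ 2M₀` (Bertrand) and `B ⊆ ℤ/M` without non-trivial 3-term progressions with
  `|B| ≥ (M/2) e^{−4√(log M)}` (Behrend, `advxxz2025_thm37`) such that for every `r ≥ 8^{3⌊log_{2N} 3^N⌋+3}`,
  **`𝒯_{τ,L,ε} ≥ ⟨⌊|B| · numalpha / (2M²r)⌋⟩ ⊗ 𝒯*_{T₀}`** — provided the first-type holes of `𝒯*_{T₀}`
  occupy at most `1/(8N)` of its `X`- and `Y`-blocks and `1/(16N)` of its `Z`-blocks (`N = c · 2n`; the
  deterministic "`O(1/n²) ≤ 1/(8N)` for sufficiently large `n`" of §6.6, `FirstTypeHoles.lean`).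

Everything is proved; one definition (`modulusBound`); no named facts.

## References

* V. Vassilevska Williams, Y. Xu, Z. Xu, R. Zhou, *New bounds for matrix multiplication: from alpha
  to omega*, SODA 2024, arXiv:2307.07970 (held: `paper:arxiv-2307.07970`), Prop. 6.2, §6.2 (the
  requirement on `M₀`, `B`), §6.6 (the final constraint on `M₀`, Claims 6.13 and 6.15).
  [VassilevskaWilliamsXuXuZhou2024]
-/

noncomputable section

open scoped BigOperators
open Finset

namespace Literature.Computability.AlgebraicComplexity

open Literature.Barriers.MatrixMultiplication (bigCwTensor)

universe u

/-! ## Level-1 blocks of `𝒯*` and merging under the chunk symmetries -/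

section StarSymmetry

variable {c n s : ℕ} (τ : Fin n → Fin s)

omit τ in
/-- Merging commutes with the action: `merge(σ · Ŵ) = σ · merge(Ŵ)`. [folklore] -/
theorem mergeHalves_actSeq (σ : Equiv.Perm (Fin n)) (Wh : Fin (n + n) → Fin c → Fin 3) :
    mergeHalves (actSeq σ Wh) = chunkPerm σ (mergeHalves Wh) := by
  funext u
  rw [chunkPerm_apply, mergeHalves_apply, mergeHalves_apply, actSeq_castAdd, actSeq_natAdd]

omit τ in
/-- Chunk levels commute with the action. [folklore] -/
theorem chunkLevels_actSeq (σ : Equiv.Perm (Fin n)) (Wh : Fin (n + n) → Fin c → Fin 3) :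
    chunkLevels (actSeq σ Wh) = actSeq σ (chunkLevels Wh) := rfl

/-- **The level-1 `X`-blocks of `𝒯*` are permuted along with the triple.** [cite: VassilevskaWilliamsXuXuZhou2024, §6.5 (𝒯*) and Def. 6.12 ("by symmetry")] -/
theorem actSeq_mem_levelBlocksX_star_iff {σ : Equiv.Perm (Fin n)} (hσ : σ ∈ chunkSymmetries τ)
    {I J K : Fin (n + n) → ℕ} (h : IsLevelTriple c I J K) (h' : IsLevelTriple c (actSeq σ I) (actSeq σ J) (actSeq σ K))
    (βX βY βZ : Fin s → ℕ × ℕ × ℕ → (Fin c → Fin 3) → ℝ) (Ih : Fin (n + n) → Fin c → Fin 3) :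
    actSeq σ Ih ∈ levelBlocksX (pairTermIdx τ h') (pairTermList c s βX βY βZ) 0 ↔
      Ih ∈ levelBlocksX (pairTermIdx τ h) (pairTermList c s βX βY βZ) 0 := by
  rw [mem_levelBlocksX_pair_iff τ h', mem_levelBlocksX_pair_iff τ h, chunkLevels_actSeq, isUsefulFor₂_actSeq_iff τ hσ]
  refine and_congr ⟨fun he => ?_, fun he => by rw [he]⟩ Iff.rfl
  have := congrArg (actSeq σ.symm) he
  rwa [actSeq_symm_actSeq, actSeq_symm_actSeq] at this

/-- The same for the `Y`-blocks. [cite: VassilevskaWilliamsXuXuZhou2024, §6.5] -/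
theorem actSeq_mem_levelBlocksY_star_iff {σ : Equiv.Perm (Fin n)} (hσ : σ ∈ chunkSymmetries τ)
    {I J K : Fin (n + n) → ℕ} (h : IsLevelTriple c I J K) (h' : IsLevelTriple c (actSeq σ I) (actSeq σ J) (actSeq σ K))
    (βX βY βZ : Fin s → ℕ × ℕ × ℕ → (Fin c → Fin 3) → ℝ) (Jh : Fin (n + n) → Fin c → Fin 3) :
    actSeq σ Jh ∈ levelBlocksY (pairTermIdx τ h') (pairTermList c s βX βY βZ) 0 ↔
      Jh ∈ levelBlocksY (pairTermIdx τ h) (pairTermList c s βX βY βZ) 0 := by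
  rw [mem_levelBlocksY_pair_iff τ h', mem_levelBlocksY_pair_iff τ h, chunkLevels_actSeq, isUsefulFor₂_actSeq_iff τ hσ]
  refine and_congr ⟨fun he => ?_, fun he => by rw [he]⟩ Iff.rfl
  have := congrArg (actSeq σ.symm) he
  rwa [actSeq_symm_actSeq, actSeq_symm_actSeq] at this

/-- The same for the `Z`-blocks. [cite: VassilevskaWilliamsXuXuZhou2024, §6.5] -/
theorem actSeq_mem_levelBlocksZ_star_iff {σ : Equiv.Perm (Fin n)} (hσ : σ ∈ chunkSymmetries τ)
    {I J K : Fin (n + n) → ℕ} (h : IsLevelTriple c I J K) (h' : IsLevelTriple c (actSeq σ I) (actSeq σ J) (actSeq σ K))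
    (βX βY βZ : Fin s → ℕ × ℕ × ℕ → (Fin c → Fin 3) → ℝ) (Kh : Fin (n + n) → Fin c → Fin 3) :
    actSeq σ Kh ∈ levelBlocksZ (pairTermIdx τ h') (pairTermList c s βX βY βZ) 0 ↔
      Kh ∈ levelBlocksZ (pairTermIdx τ h) (pairTermList c s βX βY βZ) 0 := by
  rw [mem_levelBlocksZ_pair_iff τ h', mem_levelBlocksZ_pair_iff τ h, chunkLevels_actSeq, isUsefulFor₂_actSeq_iff τ hσ]
  refine and_congr ⟨fun he => ?_, fun he => by rw [he]⟩ Iff.rfl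
  have := congrArg (actSeq σ.symm) he
  rwa [actSeq_symm_actSeq, actSeq_symm_actSeq] at this

/-- **The first-type hole sets are permuted along with the triple** (`X`). [cite: VassilevskaWilliamsXuXuZhou2024, §6.6 (first type of holes)] -/
theorem card_firstTypeHolesX_actSeq (L : Fin s → InterfaceTerm (c + c)) (ε : ℝ) {σ : Equiv.Perm (Fin n)} (hσ : σ ∈ chunkSymmetries τ)
    {I J K : Fin (n + n) → ℕ} (h : IsLevelTriple c I J K) (h' : IsLevelTriple c (actSeq σ I) (actSeq σ J) (actSeq σ K))
    (βX βY βZ : Fin s → ℕ × ℕ × ℕ → (Fin c → Fin 3) → ℝ) :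
    (firstTypeHolesX τ L ε h' βX βY βZ).card = (firstTypeHolesX τ L ε h βX βY βZ).card := by
  have hσ' : σ.symm ∈ chunkSymmetries τ := (chunkSymmetries τ).inv_mem hσ
  symm
  refine card_nbij' (actSeq σ) (actSeq σ.symm) (fun Ih hIh => ?_) (fun Ih hIh => ?_) (fun Ih _ => actSeq_symm_actSeq σ Ih)
    (fun Ih _ => actSeq_actSeq_symm σ Ih)
  · have hm := mem_filter.1 (mem_coe.1 hIh)
    refine mem_coe.2 (mem_filter.2 ⟨(actSeq_mem_levelBlocksX_star_iff τ hσ h h' βX βY βZ Ih).2 hm.1, ?_⟩)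
    rw [mergeHalves_actSeq, levelBlocksX, chunkPerm_mem_admissibleSeqs_iff hσ]; exact hm.2
  · have hm := mem_filter.1 (mem_coe.1 hIh)
    refine mem_coe.2 (mem_filter.2 ⟨?_, ?_⟩)
    · rw [← actSeq_mem_levelBlocksX_star_iff τ hσ h h' βX βY βZ, actSeq_actSeq_symm]; exact hm.1
    · rw [mergeHalves_actSeq, levelBlocksX, chunkPerm_mem_admissibleSeqs_iff hσ']; exact hm.2

/-- The same for `Y`. [cite: VassilevskaWilliamsXuXuZhou2024, §6.6] -/
theorem card_firstTypeHolesY_actSeq (L : Fin s → InterfaceTerm (c + c)) (ε : ℝ) {σ : Equiv.Perm (Fin n)} (hσ : σ ∈ chunkSymmetries τ)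
    {I J K : Fin (n + n) → ℕ} (h : IsLevelTriple c I J K) (h' : IsLevelTriple c (actSeq σ I) (actSeq σ J) (actSeq σ K))
    (βX βY βZ : Fin s → ℕ × ℕ × ℕ → (Fin c → Fin 3) → ℝ) :
    (firstTypeHolesY τ L ε h' βX βY βZ).card = (firstTypeHolesY τ L ε h βX βY βZ).card := by
  have hσ' : σ.symm ∈ chunkSymmetries τ := (chunkSymmetries τ).inv_mem hσ
  symm
  refine card_nbij' (actSeq σ) (actSeq σ.symm) (fun Jh hJh => ?_) (fun Jh hJh => ?_) (fun Jh _ => actSeq_symm_actSeq σ Jh)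
    (fun Jh _ => actSeq_actSeq_symm σ Jh)
  · have hm := mem_filter.1 (mem_coe.1 hJh)
    refine mem_coe.2 (mem_filter.2 ⟨(actSeq_mem_levelBlocksY_star_iff τ hσ h h' βX βY βZ Jh).2 hm.1, ?_⟩)
    rw [mergeHalves_actSeq, levelBlocksY, chunkPerm_mem_admissibleSeqs_iff hσ]; exact hm.2
  · have hm := mem_filter.1 (mem_coe.1 hJh)
    refine mem_coe.2 (mem_filter.2 ⟨?_, ?_⟩)
    · rw [← actSeq_mem_levelBlocksY_star_iff τ hσ h h' βX βY βZ, actSeq_actSeq_symm]; exact hm.1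
    · rw [mergeHalves_actSeq, levelBlocksY, chunkPerm_mem_admissibleSeqs_iff hσ']; exact hm.2

/-- The same for `Z`. [cite: VassilevskaWilliamsXuXuZhou2024, §6.6] -/
theorem card_firstTypeHolesZ_actSeq (L : Fin s → InterfaceTerm (c + c)) (ε : ℝ) {σ : Equiv.Perm (Fin n)} (hσ : σ ∈ chunkSymmetries τ)
    {I J K : Fin (n + n) → ℕ} (h : IsLevelTriple c I J K) (h' : IsLevelTriple c (actSeq σ I) (actSeq σ J) (actSeq σ K))
    (βX βY βZ : Fin s → ℕ × ℕ × ℕ → (Fin c → Fin 3) → ℝ) :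
    (firstTypeHolesZ τ L ε h' βX βY βZ).card = (firstTypeHolesZ τ L ε h βX βY βZ).card := by
  have hσ' : σ.symm ∈ chunkSymmetries τ := (chunkSymmetries τ).inv_mem hσ
  symm
  refine card_nbij' (actSeq σ) (actSeq σ.symm) (fun Kh hKh => ?_) (fun Kh hKh => ?_) (fun Kh _ => actSeq_symm_actSeq σ Kh)
    (fun Kh _ => actSeq_actSeq_symm σ Kh)
  · have hm := mem_filter.1 (mem_coe.1 hKh)
    refine mem_coe.2 (mem_filter.2 ⟨(actSeq_mem_levelBlocksZ_star_iff τ hσ h h' βX βY βZ Kh).2 hm.1, ?_⟩)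
    rw [mergeHalves_actSeq, levelBlocksZ, chunkPerm_mem_admissibleSeqs_iff hσ]; exact hm.2
  · have hm := mem_filter.1 (mem_coe.1 hKh)
    refine mem_coe.2 (mem_filter.2 ⟨?_, ?_⟩)
    · rw [← actSeq_mem_levelBlocksZ_star_iff τ hσ h h' βX βY βZ, actSeq_actSeq_symm]; exact hm.1
    · rw [mergeHalves_actSeq, levelBlocksZ, chunkPerm_mem_admissibleSeqs_iff hσ']; exact hm.2

end StarSymmetry

namespace ConstituentRegion

open scoped Classical

variable {c n s M₁ : ℕ} {D : ConstituentRegion c n s M₁}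

/-- **`M_Z` does not depend on the consistent triple** ("by symmetry"). [cite: VassilevskaWilliamsXuXuZhou2024, Def. 6.12 and Claim 6.15] -/
theorem usefulZCount_eq_of_mem (hD : D.WellFormed)
    {T T' : (Fin (n + n) → Fin (2 * c + 1)) × (Fin (n + n) → Fin (2 * c + 1)) × (Fin (n + n) → Fin (2 * c + 1))}
    (hT : T ∈ D.consistent) (hT' : T' ∈ D.consistent) : D.usefulZCount T = D.usefulZCount T' := by
  obtain ⟨σ, hσ, he⟩ := exists_chunkSymm_permTriple_eq hD hT hT'
  refine card_nbij' (actSeq σ) (actSeq σ.symm) (fun Kh hKh => ?_) (fun Kh hKh => ?_)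
    (fun Kh _ => actSeq_symm_actSeq σ Kh) (fun Kh _ => actSeq_actSeq_symm σ Kh)
  · have h := mem_filter.1 (mem_coe.1 hKh)
    refine mem_coe.2 (mem_filter.2 ⟨mem_univ _, ?_, ?_⟩)
    · rw [blockOfSeq_actSeq, h.2.1, ← he]; rfl
    · rw [← he, uz_permTriple_actSeq_iff hσ]; exact h.2.2
  · have h := mem_filter.1 (mem_coe.1 hKh)
    have hσ' : σ.symm ∈ chunkSymmetries D.τ := (chunkSymmetries D.τ).inv_mem hσ
    have he' : permTriple σ.symm T' = T := by rw [← he, permTriple_symm_permTriple]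
    refine mem_coe.2 (mem_filter.2 ⟨mem_univ _, ?_, ?_⟩)
    · rw [blockOfSeq_actSeq, h.2.1, ← he']; rfl
    · rw [← he', uz_permTriple_actSeq_iff hσ']; exact h.2.2

/-- **The first-type hole counts do not depend on the consistent triple** (`X`). [cite: VassilevskaWilliamsXuXuZhou2024, §6.6] -/
theorem card_firstTypeHolesX_eq_of_mem (hD : D.WellFormed)
    {T T' : (Fin (n + n) → Fin (2 * c + 1)) × (Fin (n + n) → Fin (2 * c + 1)) × (Fin (n + n) → Fin (2 * c + 1))}
    (hT : T ∈ D.consistent) (hT' : T' ∈ D.consistent)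
    (h : IsLevelTriple c (seqVal T.1) (seqVal T.2.1) (seqVal T.2.2)) (h' : IsLevelTriple c (seqVal T'.1) (seqVal T'.2.1) (seqVal T'.2.2)) :
    (firstTypeHolesX D.τ D.L D.ε h' D.βX D.βY D.βZ).card = (firstTypeHolesX D.τ D.L D.ε h D.βX D.βY D.βZ).card := by
  obtain ⟨σ, hσ, he⟩ := exists_chunkSymm_permTriple_eq hD hT hT'
  subst he
  exact card_firstTypeHolesX_actSeq D.τ D.L D.ε hσ h h' D.βX D.βY D.βZ

/-- The same for `Y`. [cite: VassilevskaWilliamsXuXuZhou2024, §6.6] -/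
theorem card_firstTypeHolesY_eq_of_mem (hD : D.WellFormed)
    {T T' : (Fin (n + n) → Fin (2 * c + 1)) × (Fin (n + n) → Fin (2 * c + 1)) × (Fin (n + n) → Fin (2 * c + 1))}
    (hT : T ∈ D.consistent) (hT' : T' ∈ D.consistent)
    (h : IsLevelTriple c (seqVal T.1) (seqVal T.2.1) (seqVal T.2.2)) (h' : IsLevelTriple c (seqVal T'.1) (seqVal T'.2.1) (seqVal T'.2.2)) :
    (firstTypeHolesY D.τ D.L D.ε h' D.βX D.βY D.βZ).card = (firstTypeHolesY D.τ D.L D.ε h D.βX D.βY D.βZ).card := by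
  obtain ⟨σ, hσ, he⟩ := exists_chunkSymm_permTriple_eq hD hT hT'
  subst he
  exact card_firstTypeHolesY_actSeq D.τ D.L D.ε hσ h h' D.βX D.βY D.βZ

/-- The same for `Z`. [cite: VassilevskaWilliamsXuXuZhou2024, §6.6] -/
theorem card_firstTypeHolesZ_eq_of_mem (hD : D.WellFormed)
    {T T' : (Fin (n + n) → Fin (2 * c + 1)) × (Fin (n + n) → Fin (2 * c + 1)) × (Fin (n + n) → Fin (2 * c + 1))}
    (hT : T ∈ D.consistent) (hT' : T' ∈ D.consistent)
    (h : IsLevelTriple c (seqVal T.1) (seqVal T.2.1) (seqVal T.2.2)) (h' : IsLevelTriple c (seqVal T'.1) (seqVal T'.2.1) (seqVal T'.2.2)) :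
    (firstTypeHolesZ D.τ D.L D.ε h' D.βX D.βY D.βZ).card = (firstTypeHolesZ D.τ D.L D.ε h D.βX D.βY D.βZ).card := by
  obtain ⟨σ, hσ, he⟩ := exists_chunkSymm_permTriple_eq hD hT hT'
  subst he
  exact card_firstTypeHolesZ_actSeq D.τ D.L D.ε hσ h h' D.βX D.βY D.βZ

/-! ## The bound `M₀` and the choice of `M` and `B` -/

variable (D) in
/-- **The bound `M₀` on the modulus** (§6.2 and §6.6, with the constants of the exact form):
`max{8 numtriple/numxblock + 1, 8 numtriple/numyblock + 1, 160 · c · 2n · V, 2c+2}` with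
`V = ⌈numalpha · C(T₀) / m⌉`. [cite: VassilevskaWilliamsXuXuZhou2024, §6.2 ("M₀ ≥ 8 max{numtriple/numxblock, numtriple/numyblock}") and §6.6 ("M₀ ≥ (numalpha · p_comp/numzblock) · n²")] -/
def modulusBound (T₀ : (Fin (n + n) → Fin (2 * c + 1)) × (Fin (n + n) → Fin (2 * c + 1)) × (Fin (n + n) → Fin (2 * c + 1))) (m : ℕ) : ℕ :=
  max (max (8 * D.tripleSet.card / (pairTypeClass D.τ D.kX).card + 1) (8 * D.tripleSet.card / (pairTypeClass D.τ D.kY).card + 1))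
    (max (160 * (c * (n + n)) * ((D.consistent.card * D.compatCount T₀ + m - 1) / m)) (2 * c + 2))

/-- Ceiling division bound: `A ≤ ⌈A/m⌉ · m` for `m ≥ 1`. [folklore] -/
theorem le_ceilDiv_mul {A m : ℕ} (hm : 0 < m) : A ≤ (A + m - 1) / m * m := by
  have h := Nat.lt_div_mul_add (a := A + m - 1) hm
  -- `A + m - 1 < ⌈⌉ m + m`, i.e. `A ≤ ⌈⌉ m`
  omega

variable (R : Type u) [CommSemiring R] (q : ℕ)

/-- **VXXZ Prop. 6.2, one region, with the hashing parameters chosen.**  For well-formed data `D` of one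
region (`c, n ≥ 1`) and a consistent reference triple `T₀`, assume: (i) a bound `m ≥ 1` on the classes of
the relevant `Z`-blocks (`m ≤ #{K̂' : ξ(K̂') = ξ(K̂)}` for every admitted `K̂` useful for a consistent
triple — Def. 6.12); (ii) the first-type hole budgets `8N |F_X(T₀)| ≤ M_X(T₀)`, `8N |F_Y(T₀)| ≤ M_Y(T₀)`,
`16N |F_Z(T₀)| ≤ M_Z(T₀)` (`N = c · 2n`).  Then there are a prime `M₀ < M ≤ 2M₀` (`M₀ = modulusBound`)
and `B ⊆ ℤ/M` free of non-trivial 3-term progressions with `|B| ≥ (M/2) e^{−4√(log M)}` such that for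
every `r ≥ 8^{3⌊log_{2N} 3^N⌋+3}`, **`𝒯_{τ,L,ε} ≥ ⟨⌊|B| · numalpha / (2M²r)⌋⟩ ⊗ 𝒯*_{T₀}`** — all the
requirements of `vxxz2024_prop62_region` follow from `M > M₀`. [cite: VassilevskaWilliamsXuXuZhou2024, Prop. 6.2, §6.2 and §6.6] -/
theorem vxxz2024_prop62_region_parameters (hD : D.WellFormed) (hc : 0 < c) (hn : 0 < n)
    {T₀ : (Fin (n + n) → Fin (2 * c + 1)) × (Fin (n + n) → Fin (2 * c + 1)) × (Fin (n + n) → Fin (2 * c + 1))}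
    (hT₀ : T₀ ∈ D.consistent) (h₀ : IsLevelTriple c (seqVal T₀.1) (seqVal T₀.2.1) (seqVal T₀.2.2)) {m : ℕ} (hm : 0 < m)
    (hclass : ∀ T ∈ D.consistent, ∀ Kh ∈ D.admZ, blockOfSeq Kh = T.2.2 → D.toHashed.UZ T Kh → m ≤ (D.shapeClass Kh).card)
    (hFX : 8 * (c * (n + n)) * (firstTypeHolesX D.τ D.L D.ε h₀ D.βX D.βY D.βZ).card ≤
      (levelBlocksX (pairTermIdx D.τ h₀) (pairTermList c s D.βX D.βY D.βZ) 0).card)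
    (hFY : 8 * (c * (n + n)) * (firstTypeHolesY D.τ D.L D.ε h₀ D.βX D.βY D.βZ).card ≤
      (levelBlocksY (pairTermIdx D.τ h₀) (pairTermList c s D.βX D.βY D.βZ) 0).card)
    (hFZ : 16 * (c * (n + n)) * (firstTypeHolesZ D.τ D.L D.ε h₀ D.βX D.βY D.βZ).card ≤
      (levelBlocksZ (pairTermIdx D.τ h₀) (pairTermList c s D.βX D.βY D.βZ) 0).card) :
    ∃ (M : ℕ) (B : Finset (ZMod M)), M.Prime ∧ D.modulusBound T₀ m < M ∧ M ≤ 2 * D.modulusBound T₀ m ∧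
      ThreeAPFree (B : Set (ZMod M)) ∧ (M : ℝ) / 2 * Real.exp (-4 * Real.sqrt (Real.log M)) ≤ B.card ∧
      ∀ {r : ℕ}, 8 ^ (3 * Nat.log (2 * (c * (n + n))) (3 ^ (c * (n + n))) + 3) ≤ r →
        TensorRestrictsTo (interfaceTensor R q D.τ D.L D.ε)
          (kroneckerTensor (unitTensor R (B.card * D.consistent.card / (2 * M ^ 2 * r))) (starTensor₂ D.τ R q h₀ D.βX D.βY D.βZ)) := by
  set M₀ := D.modulusBound T₀ m with hM₀
  have hM₀pos : M₀ ≠ 0 := by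
    have : 2 * c + 2 ≤ M₀ := le_max_of_le_right (le_max_right _ _)
    omega
  obtain ⟨M, hMprime, hM₀M, hM2M₀⟩ := Nat.exists_prime_lt_and_le_two_mul M₀ hM₀pos
  haveI : NeZero M := ⟨hMprime.ne_zero⟩
  obtain ⟨B, hBcard, hBfree'⟩ := advxxz2025_thm37 M
  have hBfree : ThreeAPFree (B : Set (ZMod M)) := GlobalStageData.threeAPFree_of_pairwise hBfree'
  refine ⟨M, B, hMprime, hM₀M, hM2M₀, hBfree, hBcard, fun {r} hr => ?_⟩
  haveI : Fact M.Prime := ⟨hMprime⟩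
  -- the data with the chosen buckets
  let D' : ConstituentRegion c n s M := { D with B := B }
  have hD' : D'.WellFormed := ⟨hD.suppX, hD.suppY, hD.suppZ, hD.revX, hD.revY⟩
  have h2c2 : 2 * c + 2 ≤ M₀ := le_max_of_le_right (le_max_right _ _)
  have hM2 : M ≠ 2 := by omega
  have hcM : 2 * c < M := by omega
  -- universe facts (unchanged by the choice of `B`)
  have hTset : D'.tripleSet = D.tripleSet := rfl
  have hcons : D'.consistent = D.consistent := rfl
  have hT₀u : T₀ ∈ D.tripleSet := filter_subset _ _ hT₀
  obtain ⟨⟨hX₀, hY₀, -⟩, -⟩ := mem_tripleUniverse.1 hT₀u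
  have hXne : 0 < (pairTypeClass D.τ D.kX).card := card_pos.2 ⟨T₀.1, hX₀⟩
  have hYne : 0 < (pairTypeClass D.τ D.kY).card := card_pos.2 ⟨T₀.2.1, hY₀⟩
  have h8X : 8 * D'.tripleSet.card ≤ M * (pairTypeClass D'.τ D'.kX).card := by
    show 8 * D.tripleSet.card ≤ M * (pairTypeClass D.τ D.kX).card
    have h1 : 8 * D.tripleSet.card / (pairTypeClass D.τ D.kX).card + 1 ≤ M₀ := le_max_of_le_left (le_max_left _ _)
    have h2 : 8 * D.tripleSet.card < (8 * D.tripleSet.card / (pairTypeClass D.τ D.kX).card + 1) * (pairTypeClass D.τ D.kX).card :=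
      Nat.lt_div_mul_add hXne |>.trans_le (by rw [Nat.add_mul, one_mul])
    exact h2.le.trans (Nat.mul_le_mul_right _ (by omega))
  have h8Y : 8 * D'.tripleSet.card ≤ M * (pairTypeClass D'.τ D'.kY).card := by
    show 8 * D.tripleSet.card ≤ M * (pairTypeClass D.τ D.kY).card
    have h1 : 8 * D.tripleSet.card / (pairTypeClass D.τ D.kY).card + 1 ≤ M₀ := le_max_of_le_left (le_max_right _ _)
    have h2 : 8 * D.tripleSet.card < (8 * D.tripleSet.card / (pairTypeClass D.τ D.kY).card + 1) * (pairTypeClass D.τ D.kY).card :=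
      Nat.lt_div_mul_add hYne |>.trans_le (by rw [Nat.add_mul, one_mul])
    exact h2.le.trans (Nat.mul_le_mul_right _ (by omega))
  -- the hole threshold `h` and the final constraint
  set Z := D.usefulZCount T₀ with hZ
  set F := (firstTypeHolesZ D.τ D.L D.ε h₀ D.βX D.βY D.βZ).card with hF
  set N' := 8 * (c * (n + n)) with hN'
  set V := (D.consistent.card * D.compatCount T₀ + m - 1) / m with hV
  set h := (Z - N' * F) / N' with hh
  have hNpos : 0 < N' := by rw [hN']; positivity
  have hZeq : Z = (levelBlocksZ (pairTermIdx D.τ h₀) (pairTermList c s D.βX D.βY D.βZ) 0).card := usefulZCount_eq_card_levelBlocksZ h₀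
  -- `N'(h+1) > Z − N'F ≥ Z/2`
  have h2F : 2 * (N' * F) ≤ Z := by rw [hZeq, hN']; linarith [hFZ]
  have hhlt : Z - N' * F < (h + 1) * N' := by
    rw [hh]; exact Nat.lt_div_mul_add hNpos |>.trans_le (by rw [Nat.add_mul, one_mul])
  have hZle : Z ≤ 2 * ((h + 1) * N') := by omega
  have hMV : 160 * (c * (n + n)) * V ≤ M := (le_max_of_le_right (le_max_left _ _) : 160 * (c * (n + n)) * V ≤ M₀).trans hM₀M.le
  have hU : ∀ T ∈ D'.consistent, 10 * ((D'.toHashed.holePairsIn D'.admZ T).card * M ^ (n + n - 1)) ≤ (h + 1) * M ^ (n + n) := by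
    intro T hT
    have hTc : T ∈ D.consistent := hT
    -- `U_A(T) m ≤ Z numalpha C`
    have hUm : (D'.toHashed.holePairsIn D'.admZ T).card * m ≤ D'.usefulZCount T * (D'.consistent.card * D'.compatCount T₀) :=
      card_holePairsIn_mul_le hD' D'.admZ hT₀ fun Kh hKh hb hu => hclass T hTc Kh hKh hb hu
    have hZT : D'.usefulZCount T = Z := usefulZCount_eq_of_mem hD' hT hT₀
    rw [hZT] at hUm
    -- hence `U_A(T) ≤ Z V`
    have hUle : (D'.toHashed.holePairsIn D'.admZ T).card ≤ Z * V := by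
      have hAC : D'.consistent.card * D'.compatCount T₀ ≤ V * m := le_ceilDiv_mul hm
      have : (D'.toHashed.holePairsIn D'.admZ T).card * m ≤ Z * V * m := by
        calc (D'.toHashed.holePairsIn D'.admZ T).card * m ≤ Z * (D'.consistent.card * D'.compatCount T₀) := hUm
          _ ≤ Z * (V * m) := Nat.mul_le_mul_left _ hAC
          _ = Z * V * m := by ring
      exact Nat.le_of_mul_le_mul_right this hm
    have hn' : M ^ (n + n) = M * M ^ (n + n - 1) := by
      rw [← pow_succ']; congr 1; omega
    rw [hn']
    have key : 10 * (Z * V) ≤ (h + 1) * M := by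
      calc 10 * (Z * V) ≤ 10 * (2 * ((h + 1) * N') * V) := Nat.mul_le_mul_left _ (Nat.mul_le_mul_right _ hZle)
        _ = (h + 1) * (20 * N' * V) := by ring
        _ = (h + 1) * (160 * (c * (n + n)) * V) := by rw [hN']; ring
        _ ≤ (h + 1) * M := Nat.mul_le_mul_left _ hMV
    calc 10 * ((D'.toHashed.holePairsIn D'.admZ T).card * M ^ (n + n - 1)) ≤ 10 * (Z * V * M ^ (n + n - 1)) :=
          Nat.mul_le_mul_left _ (Nat.mul_le_mul_right _ hUle)
      _ = 10 * (Z * V) * M ^ (n + n - 1) := by ring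
      _ ≤ (h + 1) * M * M ^ (n + n - 1) := Nat.mul_le_mul_right _ key
      _ = (h + 1) * (M * M ^ (n + n - 1)) := by ring
  -- the hole budgets at every consistent `T` (uniform in `T`)
  have hbudZ : 8 * (c * (n + n)) * (F + h) ≤ (levelBlocksZ (pairTermIdx D.τ h₀) (pairTermList c s D.βX D.βY D.βZ) 0).card := by
    rw [← hZeq, ← hN', Nat.mul_add]
    have : N' * h ≤ Z - N' * F := by rw [hh, mul_comm]; exact Nat.div_mul_le_self _ _
    omega
  have hHX : ∀ T ∈ D'.consistent, ∀ hT : IsLevelTriple c (seqVal T.1) (seqVal T.2.1) (seqVal T.2.2),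
      8 * (c * (n + n)) * (firstTypeHolesX D'.τ D'.L D'.ε hT D'.βX D'.βY D'.βZ).card ≤
        (levelBlocksX (pairTermIdx D'.τ h₀) (pairTermList c s D'.βX D'.βY D'.βZ) 0).card := by
    intro T hT hT'
    rw [show (firstTypeHolesX D'.τ D'.L D'.ε hT' D'.βX D'.βY D'.βZ).card = (firstTypeHolesX D.τ D.L D.ε h₀ D.βX D.βY D.βZ).card from
      card_firstTypeHolesX_eq_of_mem hD hT₀ hT h₀ hT']
    exact hFX
  have hHY : ∀ T ∈ D'.consistent, ∀ hT : IsLevelTriple c (seqVal T.1) (seqVal T.2.1) (seqVal T.2.2),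
      8 * (c * (n + n)) * (firstTypeHolesY D'.τ D'.L D'.ε hT D'.βX D'.βY D'.βZ).card ≤
        (levelBlocksY (pairTermIdx D'.τ h₀) (pairTermList c s D'.βX D'.βY D'.βZ) 0).card := by
    intro T hT hT'
    rw [show (firstTypeHolesY D'.τ D'.L D'.ε hT' D'.βX D'.βY D'.βZ).card = (firstTypeHolesY D.τ D.L D.ε h₀ D.βX D.βY D.βZ).card from
      card_firstTypeHolesY_eq_of_mem hD hT₀ hT h₀ hT']
    exact hFY
  have hHZ : ∀ T ∈ D'.consistent, ∀ hT : IsLevelTriple c (seqVal T.1) (seqVal T.2.1) (seqVal T.2.2),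
      8 * (c * (n + n)) * ((firstTypeHolesZ D'.τ D'.L D'.ε hT D'.βX D'.βY D'.βZ).card + h) ≤
        (levelBlocksZ (pairTermIdx D'.τ h₀) (pairTermList c s D'.βX D'.βY D'.βZ) 0).card := by
    intro T hT hT'
    rw [show (firstTypeHolesZ D'.τ D'.L D'.ε hT' D'.βX D'.βY D'.βZ).card = F from card_firstTypeHolesZ_eq_of_mem hD hT₀ hT h₀ hT']
    exact hbudZ
  exact vxxz2024_prop62_region R q hD' hM2 hcM hc hn hBfree h8X h8Y hU hT₀ h₀ hHX hHY hHZ hr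

end ConstituentRegion

end Literature.Computability.AlgebraicComplexity
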